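import Mathlib
import HarnessLib

/-!
# Drift engine — crux `stmt-AtomisticToContinuum-16624` (`TwoClocks.TransferActivityTails`), line `Sketch`

Stub `stub_driftEngine : DriftEngine` of the line skeleton (card `predictor-drift-doob`): pure probability on an arbitrary
probability space (no hard spheres) — nonnegative measurable blocks `X₀, X₁, …` with an integrated one-step drift of `X_j`
given the history `(X₀, …, X_{j-1})` yield an event bound for the block average `K⁻¹ Σ_{j<K} X_j`.

Proof: truncate `Y_j = X_j ∧ M` (`trunc`); Doob decomposition `Y_j = π_j + D_j` along the natural filtration
`natF X j = σ(X₀, …, X_{j-1})` (the pull-back of the product σ-algebra under the history map), `π_j = P[Y_j | natF X j]`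
(`pred`).  Testing the drift against the indicator of the `natF X j`-measurable event `{π_j > ρ H_j + C}` — a preimage
under the history map — gives `π_j ≤ ρ H_j + C` a.e. (`condExp_le_of_drift`; `X_j` need not be integrable).  A pointwise
count (`pointwise_engine`) shows that on the bad event one of `Σ_{j<L} X_j ≥ K`, `Σ_{j<K} (X_j - M)₊ ≥ K`,
`Σ_{L ≤ j < K} D_j > 2K` holds.  The `D_j` are bounded by `M` and orthogonal (pull-out property), so
`E[(Σ D_j)²] ≤ K M²` (`integral_msum_sq_le`) and Markov's inequality finishes (`measure_msum_gt_le`).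
-/

noncomputable section

open MeasureTheory Filter Set
open scoped ENNReal BigOperators

namespace Summit.AtomisticToContinuum.HydrodynamicLimit.Theorems.TransferActivityTailsDriftEngine

/-- **Drift ⇒ time-average engine** (abstract probability).  Nonnegative measurable `X₀, X₁, …` on a probability
space; `0 ≤ ρ < 1`, `0 ≤ C`, history length `1 ≤ L < K`, truncation level `0 ≤ M`; integrated one-step drift
`E[X_{j+1} g(X₀,…,X_j)] ≤ E[(ρ·L⁻¹Σ_{k<L} X_{j+1−L+k} + C) g(X₀,…,X_j)]` for every measurable `[0,1]`-valued `g`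
and every `j` with `L ≤ j+1 < K`.  Then the block average `ā = K⁻¹ Σ_{j<K} X_j` satisfies
`P(ā > 4(C+1)/(1−ρ)) ≤ P(K ≤ Σ_{j<L} X_j) + P(K ≤ Σ_{j<K} (X_j − M)₊) + M²/(4K)`.
Proof: `Y_j = X_j ∧ M`; Doob decomposition `Y_j = D_j + π_j`, `π_j = E[Y_j | σ(X₀..X_{j−1})] ≤ ρH_{j−1} + C` a.s.
(drift with `g = 𝟙{π_j > ρH_{j−1}+C}`); `Σ_{j≥L} H_{j−1} ≤ Σ_j X_j`; so
`(1−ρ)Kā ≤ Σ_{j<L}X_j + Σ_j(X_j−M)₊ + Σ_{j≥L}D_j + CK`, and on `{ā > 4(C+1)/(1−ρ)}` one of the three sums is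
`≥ K`, `≥ K`, `> 2K`; the `D_j` are bounded by `M` and orthogonal, `P(ΣD_j > 2K) ≤ KM²/(4K²)` (Chebyshev). -/
def DriftEngine : Prop :=
  ∀ (Ω : Type) [MeasurableSpace Ω] (P : Measure Ω) [IsProbabilityMeasure P] (K L : ℕ) (X : ℕ → Ω → ℝ)
    (ρ C M : ℝ),
    (∀ j, Measurable (X j)) → (∀ j ω, 0 ≤ X j ω) → 0 ≤ ρ → ρ < 1 → 0 ≤ C → 1 ≤ L → L < K → 0 ≤ M →
    (∀ j : ℕ, L ≤ j + 1 → j + 1 < K → ∀ g : (Fin (j + 1) → ℝ) → ℝ, Measurable g → (∀ y, 0 ≤ g y ∧ g y ≤ 1) →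
      ∫⁻ ω, ENNReal.ofReal (X (j + 1) ω * g (fun k => X k ω)) ∂P ≤
      ∫⁻ ω, ENNReal.ofReal ((ρ * ((L : ℝ)⁻¹ * ∑ k ∈ Finset.range L, X (j + 1 - L + k) ω) + C) *
        g (fun k => X k ω)) ∂P) →
    P {ω | 4 * (C + 1) / (1 - ρ) < (K : ℝ)⁻¹ * ∑ j ∈ Finset.range K, X j ω} ≤
      P {ω | (K : ℝ) ≤ ∑ j ∈ Finset.range L, X j ω} +
        P {ω | (K : ℝ) ≤ ∑ j ∈ Finset.range K, max (X j ω - M) 0} +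
        ENNReal.ofReal (M ^ 2 / (4 * K))

/-! ## The natural filtration of a real sequence -/

section Filtration

variable {Ω : Type*}

/-- The natural filtration of `X` (strict past): `natF X n = σ(X₀, …, X_{n-1})`, realised as the pull-back of the product
σ-algebra on `Fin n → ℝ` under the history map `ω ↦ (X₀ ω, …, X_{n-1} ω)`. -/
@[reducible] def natF (X : ℕ → Ω → ℝ) (n : ℕ) : MeasurableSpace Ω :=
  MeasurableSpace.comap (fun ω (k : Fin n) => X k ω) inferInstance

/-- Each past coordinate `X l`, `l < n`, is `natF X n`-measurable. -/
theorem measurable_natF_of_lt (X : ℕ → Ω → ℝ) {n l : ℕ} (h : l < n) : Measurable[natF X n] (X l) := by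
  have h1 : Measurable[natF X n] fun ω (k : Fin n) => X k ω := comap_measurable _
  exact (measurable_pi_apply (⟨l, h⟩ : Fin n)).comp h1

/-- The natural filtration is monotone. -/
theorem natF_mono (X : ℕ → Ω → ℝ) {m n : ℕ} (h : m ≤ n) : natF X m ≤ natF X n := by
  letI : MeasurableSpace Ω := natF X n
  exact (measurable_pi_lambda (fun ω (k : Fin m) => X k ω) fun k => measurable_natF_of_lt X (k.2.trans_le h)).comap_le

/-- The natural filtration consists of sub-σ-algebras of the ambient one when the `X j` are measurable. -/
theorem natF_le {mΩ : MeasurableSpace Ω} {X : ℕ → Ω → ℝ} (hX : ∀ j, Measurable (X j)) (n : ℕ) : natF X n ≤ mΩ :=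
  (measurable_pi_lambda (fun ω (k : Fin n) => X k ω) fun k => hX k).comap_le

end Filtration

/-! ## From the integrated drift to an a.e. bound on the predictor -/

section Drift

variable {Ω : Type*} {mΩ : MeasurableSpace Ω} {P : Measure Ω} [IsFiniteMeasure P]

/-- An a.e. bounded measurable real function on a finite measure space is integrable. -/
theorem integrable_of_abs_le {f : Ω → ℝ} (hf : Measurable f) {R : ℝ} (h : ∀ᵐ ω ∂P, |f ω| ≤ R) : Integrable f P :=
  Integrable.of_bound hf.aestronglyMeasurable R (h.mono fun ω hω => by simpa only [Real.norm_eq_abs] using hω)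

/-- The product of two a.e. bounded measurable real functions on a finite measure space is integrable. -/
theorem integrable_mul_of_abs_le {f g : Ω → ℝ} (hf : Measurable f) (hg : Measurable g) {R S : ℝ} (hfR : ∀ᵐ ω ∂P, |f ω| ≤ R)
    (hgS : ∀ᵐ ω ∂P, |g ω| ≤ S) : Integrable (fun ω => f ω * g ω) P := by
  refine integrable_of_abs_le (hf.mul hg) (R := R * S) ?_
  filter_upwards [hfR, hgS] with ω h1 h2
  rw [abs_mul]
  exact mul_le_mul h1 h2 (abs_nonneg _) ((abs_nonneg _).trans h1)

/-- Pull-out property, integrated: for `m`-measurable `Z`, `∫ Z · P[Y|m] = ∫ Z · Y`. -/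
theorem integral_mul_condExp {m : MeasurableSpace Ω} (hm : m ≤ mΩ) {Z Y : Ω → ℝ} (hZ : Measurable[m] Z)
    (hZY : Integrable (fun ω => Z ω * Y ω) P) (hY : Integrable Y P) : ∫ ω, Z ω * P[Y|m] ω ∂P = ∫ ω, Z ω * Y ω ∂P :=
  (integral_congr_ae (condExp_mul_of_stronglyMeasurable_left hZ.stronglyMeasurable hZY hY)).symm.trans (integral_condExp hm)

/-- **Drift ⇒ predictor bound.**  If `0 ≤ Y ≤ M`, `Y ≤ Xn`, `B ≥ 0` is `σ(h)`-measurable and `∫⁻ Xn·g(h) ≤ ∫⁻ B·g(h)` for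
every measurable `[0,1]`-valued `g`, then `P[Y | σ(h)] ≤ B` a.e.  (Test with `g` the indicator of the `σ(h)`-measurable
event `{B < P[Y | σ(h)]}`, a preimage under `h`; `Xn` need not be integrable.) -/
theorem condExp_le_of_drift {S : Type*} [MeasurableSpace S] {h : Ω → S} (hh : Measurable h) {Xn Y B : Ω → ℝ} {M : ℝ}
    (hM : 0 ≤ M) (hY : Measurable Y) (hY0 : ∀ ω, 0 ≤ Y ω) (hYM : ∀ ω, Y ω ≤ M) (hYX : ∀ ω, Y ω ≤ Xn ω)
    (hB : Measurable[MeasurableSpace.comap h inferInstance] B) (hB0 : ∀ ω, 0 ≤ B ω)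
    (hdrift : ∀ g : S → ℝ, Measurable g → (∀ y, 0 ≤ g y ∧ g y ≤ 1) →
      ∫⁻ ω, ENNReal.ofReal (Xn ω * g (h ω)) ∂P ≤ ∫⁻ ω, ENNReal.ofReal (B ω * g (h ω)) ∂P) :
    ∀ᵐ ω ∂P, P[Y|MeasurableSpace.comap h inferInstance] ω ≤ B ω := by
  set m : MeasurableSpace Ω := MeasurableSpace.comap h inferInstance
  have hm : m ≤ mΩ := hh.comap_le
  have hπM : ∀ᵐ ω ∂P, P[Y|m] ω ≤ M := condExp_le_nonneg_const hM (ae_of_all _ hYM)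
  -- the bad event is `σ(h)`-measurable, hence the preimage under `h` of a measurable `T`
  obtain ⟨T, hT, hTA⟩ := MeasurableSpace.measurableSet_comap.1
    (measurableSet_lt hB stronglyMeasurable_condExp.measurable : MeasurableSet[m] {ω | B ω < P[Y|m] ω})
  have hmem : ∀ ω, h ω ∈ T ↔ B ω < P[Y|m] ω := fun ω => Set.ext_iff.1 hTA ω
  -- the test function `g = 𝟙_T`, so that `g ∘ h` is the indicator of the bad event
  set g : S → ℝ := T.indicator fun _ => (1 : ℝ) with hg_def
  have hg : Measurable g := measurable_const.indicator hT
  have hg1 : ∀ y, y ∈ T → g y = 1 := fun y hy => by rw [hg_def, Set.indicator_of_mem hy]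
  have hg0 : ∀ y, y ∉ T → g y = 0 := fun y hy => by rw [hg_def, Set.indicator_of_notMem hy]
  have hg01 : ∀ y, 0 ≤ g y ∧ g y ≤ 1 := fun y => by by_cases hy : y ∈ T <;> [rw [hg1 y hy]; rw [hg0 y hy]] <;> norm_num
  have hgn : ∀ᵐ ω ∂P, ‖g (h ω)‖ ≤ 1 :=
    ae_of_all _ fun ω => by rw [Real.norm_eq_abs, abs_of_nonneg (hg01 _).1]; exact (hg01 _).2
  -- integrability of the tested functions (`B g(h) ≤ P[Y|m] ≤ M` a.e. on the bad event)
  have hYi : Integrable Y P := integrable_of_abs_le hY (ae_of_all _ fun ω => by rw [abs_of_nonneg (hY0 ω)]; exact hYM ω)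
  have hYg : Integrable (fun ω => Y ω * g (h ω)) P := hYi.mul_bdd (hg.comp hh).aestronglyMeasurable hgn
  have hπg : Integrable (fun ω => g (h ω) * P[Y|m] ω) P :=
    (integrable_condExp (m := m) (μ := P) (f := Y)).bdd_mul (hg.comp hh).aestronglyMeasurable hgn
  have hBg : Integrable (fun ω => B ω * g (h ω)) P := by
    refine integrable_of_abs_le ((hB.mono hm le_rfl).mul (hg.comp hh)) (R := M) ?_
    filter_upwards [hπM] with ω hω
    rw [abs_of_nonneg (mul_nonneg (hB0 ω) (hg01 _).1)]
    by_cases hωT : h ω ∈ T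
    · rw [hg1 _ hωT, mul_one]; linarith [(hmem ω).1 hωT]
    · rw [hg0 _ hωT, mul_zero]; exact hM
  -- from the drift, `∫ Y g(h) ≤ ∫ B g(h)`; by the pull-out property, `∫ g(h) P[Y|m] = ∫ g(h) Y`
  have h1 : ∫ ω, Y ω * g (h ω) ∂P ≤ ∫ ω, B ω * g (h ω) ∂P := by
    refine (ENNReal.ofReal_le_ofReal_iff (integral_nonneg fun ω => mul_nonneg (hB0 ω) (hg01 _).1)).1 ?_
    rw [ofReal_integral_eq_lintegral_ofReal hYg (ae_of_all _ fun ω => mul_nonneg (hY0 ω) (hg01 _).1),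
      ofReal_integral_eq_lintegral_ofReal hBg (ae_of_all _ fun ω => mul_nonneg (hB0 ω) (hg01 _).1)]
    exact (lintegral_mono fun ω => ENNReal.ofReal_le_ofReal (mul_le_mul_of_nonneg_right (hYX ω) (hg01 _).1)).trans
      (hdrift g hg hg01)
  have h2 : ∫ ω, g (h ω) * P[Y|m] ω ∂P = ∫ ω, g (h ω) * Y ω ∂P :=
    integral_mul_condExp hm (hg.comp (comap_measurable h)) (by simpa only [mul_comm] using hYg) hYi
  -- the nonnegative function `(P[Y|m] - B) g(h)` has nonpositive integral, hence vanishes a.e.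
  have hφ0 : ∀ ω, 0 ≤ (P[Y|m] ω - B ω) * g (h ω) := fun ω => by
    by_cases hωT : h ω ∈ T
    · exact mul_nonneg (sub_nonneg.2 ((hmem ω).1 hωT).le) (hg01 _).1
    · rw [hg0 _ hωT, mul_zero]
  have hφ : (fun ω => (P[Y|m] ω - B ω) * g (h ω)) = fun ω => g (h ω) * P[Y|m] ω - B ω * g (h ω) := by funext ω; ring
  have hφ_ae : (fun ω => (P[Y|m] ω - B ω) * g (h ω)) =ᵐ[P] 0 := by
    refine (integral_eq_zero_iff_of_nonneg hφ0 (by rw [hφ]; exact hπg.sub hBg)).1 (le_antisymm ?_ (integral_nonneg hφ0))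
    rw [hφ, integral_sub hπg hBg, h2, sub_nonpos]
    simpa only [mul_comm] using h1
  filter_upwards [hφ_ae] with ω hω
  by_contra hlt
  rw [hg1 _ ((hmem ω).2 (not_le.1 hlt)), mul_one, Pi.zero_apply] at hω
  linarith [not_le.1 hlt]

end Drift

/-! ## Doob decomposition of the truncated blocks; second moment of the martingale part -/

section Engine

variable {Ω : Type*} {mΩ : MeasurableSpace Ω} (X : ℕ → Ω → ℝ) (M : ℝ) (P : Measure Ω)

/-- Truncated block `Y_j = X_j ∧ M`. -/
def trunc (j : ℕ) : Ω → ℝ := fun ω => min (X j ω) M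

/-- Predictor `π_j = P[Y_j | σ(X₀, …, X_{j-1})]`. -/
def pred (j : ℕ) : Ω → ℝ := P[trunc X M j|natF X j]

/-- Partial sums `Σ_{L ≤ j < n} D_j` of the martingale increments `D_j = Y_j - π_j`. -/
def msum (L n : ℕ) : Ω → ℝ := fun ω => ∑ j ∈ Finset.Ico L n, (trunc X M j ω - pred X M P j ω)

variable {X M P}

/-- `|Y_j| ≤ M` (for `X ≥ 0`, `M ≥ 0`). -/
theorem abs_trunc_le (hX0 : ∀ j ω, 0 ≤ X j ω) (hM : 0 ≤ M) (j : ℕ) (ω : Ω) : |trunc X M j ω| ≤ M :=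
  abs_le.2 ⟨(neg_nonpos.2 hM).trans (le_min (hX0 j ω) hM), min_le_right _ _⟩

/-- `π_j` is `natF X j`-measurable. -/
theorem measurable_pred_natF (X : ℕ → Ω → ℝ) (M : ℝ) (P : Measure Ω) (j : ℕ) : Measurable[natF X j] (pred X M P j) :=
  stronglyMeasurable_condExp.measurable

/-- The increment `D_j = Y_j - π_j` is `natF X n`-measurable for `j < n`. -/
theorem measurable_incr_natF (X : ℕ → Ω → ℝ) (M : ℝ) (P : Measure Ω) {j n : ℕ} (h : j < n) :
    Measurable[natF X n] fun ω => trunc X M j ω - pred X M P j ω :=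
  ((measurable_natF_of_lt X h).min measurable_const).sub ((measurable_pred_natF X M P j).mono (natF_mono X h.le) le_rfl)

/-- `Σ_{L ≤ j < n} D_j` is `natF X n`-measurable. -/
theorem measurable_msum_natF (X : ℕ → Ω → ℝ) (M : ℝ) (P : Measure Ω) (L n : ℕ) : Measurable[natF X n] (msum X M P L n) :=
  Finset.measurable_sum _ fun _ hj => measurable_incr_natF X M P (Finset.mem_Ico.1 hj).2

/-- `Σ_{L ≤ j < n} D_j` is measurable. -/
theorem measurable_msum (hX : ∀ j, Measurable (X j)) (M : ℝ) (P : Measure Ω) (L n : ℕ) : Measurable (msum X M P L n) :=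
  (measurable_msum_natF X M P L n).mono (natF_le hX n) le_rfl

/-- `|D_j| ≤ M` a.e., simultaneously for all `j` (as `0 ≤ Y_j, π_j ≤ M`). -/
theorem incr_bd (hX0 : ∀ j ω, 0 ≤ X j ω) (hM : 0 ≤ M) : ∀ᵐ ω ∂P, ∀ j, |trunc X M j ω - pred X M P j ω| ≤ M := by
  refine ae_all_iff.2 fun j => ?_
  have h0 : ∀ ω, 0 ≤ trunc X M j ω := fun ω => le_min (hX0 j ω) hM
  have hM' : ∀ ω, trunc X M j ω ≤ M := fun ω => min_le_right _ _
  filter_upwards [condExp_nonneg (m := natF X j) (ae_of_all P h0), condExp_le_nonneg_const (m := natF X j) hM (ae_of_all P hM')]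
    with ω h1 h2
  have h1' : 0 ≤ pred X M P j ω := h1; have h2' : pred X M P j ω ≤ M := h2; have h3 := hM' ω; have h4 := h0 ω
  rw [abs_sub_le_iff]; constructor <;> linarith

/-- `|Σ_{L ≤ j < n} D_j| ≤ n M` a.e., simultaneously for all `n`. -/
theorem msum_bd (hX0 : ∀ j ω, 0 ≤ X j ω) (hM : 0 ≤ M) (L : ℕ) : ∀ᵐ ω ∂P, ∀ n, |msum X M P L n ω| ≤ n * M := by
  filter_upwards [incr_bd hX0 hM] with ω hω n
  calc |msum X M P L n ω| ≤ ∑ j ∈ Finset.Ico L n, |trunc X M j ω - pred X M P j ω| := Finset.abs_sum_le_sum_abs _ _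
    _ ≤ ∑ j ∈ Finset.Ico L n, M := Finset.sum_le_sum fun j _ => hω j
    _ ≤ n * M := by
      rw [Finset.sum_const, Nat.card_Ico, nsmul_eq_mul]
      exact mul_le_mul_of_nonneg_right (by exact_mod_cast Nat.sub_le n L) hM

variable [IsProbabilityMeasure P]

/-- `(Σ_{L ≤ j < n} D_j)²` is integrable. -/
theorem integrable_msum_sq (hX : ∀ j, Measurable (X j)) (hX0 : ∀ j ω, 0 ≤ X j ω) (hM : 0 ≤ M) (L n : ℕ) :
    Integrable (fun ω => msum X M P L n ω ^ 2) P := by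
  simpa only [sq] using integrable_mul_of_abs_le (measurable_msum hX M P L n) (measurable_msum hX M P L n)
    ((msum_bd hX0 hM L).mono fun ω hω => hω n) ((msum_bd hX0 hM L).mono fun ω hω => hω n)

/-- **Orthogonality of the increments**: `∫ (Σ_{L ≤ j < n} D_j) · D_n = 0` (pull-out property: the partial sum is
`natF X n`-measurable and `P[D_n | natF X n] = 0`). -/
theorem integral_msum_mul_incr (hX : ∀ j, Measurable (X j)) (hX0 : ∀ j ω, 0 ≤ X j ω) (hM : 0 ≤ M) (L n : ℕ) :
    ∫ ω, msum X M P L n ω * (trunc X M n ω - pred X M P n ω) ∂P = 0 := by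
  have hSbd : ∀ᵐ ω ∂P, ‖msum X M P L n ω‖ ≤ n * M := (msum_bd hX0 hM L).mono fun ω hω => (Real.norm_eq_abs _).trans_le (hω n)
  have hS : AEStronglyMeasurable (msum X M P L n) P := (measurable_msum hX M P L n).aestronglyMeasurable
  have hYi : Integrable (trunc X M n) P := integrable_of_abs_le ((hX n).min measurable_const) (ae_of_all _ (abs_trunc_le hX0 hM n))
  have hSY : Integrable (fun ω => msum X M P L n ω * trunc X M n ω) P := hYi.bdd_mul hS hSbd
  have hSπ : Integrable (fun ω => msum X M P L n ω * pred X M P n ω) P :=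
    (integrable_condExp (m := natF X n) (μ := P) (f := trunc X M n)).bdd_mul hS hSbd
  have hpull : ∫ ω, msum X M P L n ω * pred X M P n ω ∂P = ∫ ω, msum X M P L n ω * trunc X M n ω ∂P :=
    integral_mul_condExp (natF_le hX n) (measurable_msum_natF X M P L n) hSY hYi
  simp only [mul_sub]
  rw [integral_sub hSY hSπ, hpull, sub_self]

/-- **Second moment of the martingale part**: `∫ (Σ_{L ≤ j < n} D_j)² ≤ (n - L) M²` (orthogonality and `|D_j| ≤ M`). -/
theorem integral_msum_sq_le (hX : ∀ j, Measurable (X j)) (hX0 : ∀ j ω, 0 ≤ X j ω) (hM : 0 ≤ M) {L n : ℕ} (hLn : L ≤ n) :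
    ∫ ω, msum X M P L n ω ^ 2 ∂P ≤ ((n : ℝ) - L) * M ^ 2 := by
  induction n, hLn using Nat.le_induction with
  | base => simp [msum]
  | succ n hLn ih =>
    have hDbd : ∀ᵐ ω ∂P, |trunc X M n ω - pred X M P n ω| ≤ M := (incr_bd hX0 hM).mono fun ω hω => hω n
    have hSbd : ∀ᵐ ω ∂P, |msum X M P L n ω| ≤ n * M := (msum_bd hX0 hM L).mono fun ω hω => hω n
    have hDm : Measurable fun ω => trunc X M n ω - pred X M P n ω :=
      (measurable_incr_natF X M P n.lt_succ_self).mono (natF_le hX _) le_rfl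
    have h1 : Integrable (fun ω => msum X M P L n ω ^ 2) P := integrable_msum_sq hX hX0 hM L n
    have h2 : Integrable (fun ω => 2 * (msum X M P L n ω * (trunc X M n ω - pred X M P n ω))) P :=
      (integrable_mul_of_abs_le (measurable_msum hX M P L n) hDm hSbd hDbd).const_mul 2
    have h12 : Integrable (fun ω => msum X M P L n ω ^ 2 + 2 * (msum X M P L n ω * (trunc X M n ω - pred X M P n ω))) P :=
      h1.add h2
    have h3 : Integrable (fun ω => (trunc X M n ω - pred X M P n ω) ^ 2) P := by
      simpa only [sq] using integrable_mul_of_abs_le hDm hDm hDbd hDbd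
    have h4 : ∫ ω, (trunc X M n ω - pred X M P n ω) ^ 2 ∂P ≤ M ^ 2 :=
      (integral_mono_ae h3 (integrable_const _) (hDbd.mono fun ω hω => sq_le_sq.2 (by rwa [abs_of_nonneg hM]))).trans (by simp)
    have hexp : (fun ω => msum X M P L (n + 1) ω ^ 2) = fun ω => msum X M P L n ω ^ 2 +
        2 * (msum X M P L n ω * (trunc X M n ω - pred X M P n ω)) + (trunc X M n ω - pred X M P n ω) ^ 2 := by
      funext ω
      rw [show msum X M P L (n + 1) ω = msum X M P L n ω + (trunc X M n ω - pred X M P n ω) from Finset.sum_Ico_succ_top hLn _]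
      ring
    rw [hexp, integral_add h12 h3, integral_add h1 h2, integral_const_mul, integral_msum_mul_incr hX hX0 hM, mul_zero, add_zero]
    push_cast
    linarith

/-- **Chebyshev for the martingale part**: `P(2K < Σ_{L ≤ j < K} D_j) ≤ M²/(4K)`. -/
theorem measure_msum_gt_le (hX : ∀ j, Measurable (X j)) (hX0 : ∀ j ω, 0 ≤ X j ω) (hM : 0 ≤ M) {L K : ℕ} (hLK : L < K) :
    P {ω | 2 * (K : ℝ) < msum X M P L K ω} ≤ ENNReal.ofReal (M ^ 2 / (4 * K)) := by
  have hK : (0 : ℝ) < K := by exact_mod_cast lt_of_le_of_lt (Nat.zero_le L) hLK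
  have hmarkov := mul_meas_ge_le_integral_of_nonneg (ae_of_all _ fun ω => sq_nonneg (msum X M P L K ω))
    (integrable_msum_sq hX hX0 hM L K) ((2 * (K : ℝ)) ^ 2)
  have hI : ∫ ω, msum X M P L K ω ^ 2 ∂P ≤ K * M ^ 2 :=
    (integral_msum_sq_le hX hX0 hM hLK.le).trans (mul_le_mul_of_nonneg_right (by linarith [L.cast_nonneg (α := ℝ)]) (sq_nonneg M))
  have hreal : P.real {ω | (2 * (K : ℝ)) ^ 2 ≤ msum X M P L K ω ^ 2} ≤ M ^ 2 / (4 * K) := by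
    rw [le_div_iff₀ (by positivity)]
    refine le_of_mul_le_mul_left ?_ hK
    calc (K : ℝ) * (P.real {ω | (2 * (K : ℝ)) ^ 2 ≤ msum X M P L K ω ^ 2} * (4 * K))
        = (2 * (K : ℝ)) ^ 2 * P.real {ω | (2 * (K : ℝ)) ^ 2 ≤ msum X M P L K ω ^ 2} := by ring
      _ ≤ K * M ^ 2 := hmarkov.trans hI
  calc P {ω | 2 * (K : ℝ) < msum X M P L K ω} ≤ P {ω | (2 * (K : ℝ)) ^ 2 ≤ msum X M P L K ω ^ 2} :=
        measure_mono fun ω hω => by simp only [Set.mem_setOf_eq] at hω ⊢; exact pow_le_pow_left₀ (by positivity) hω.le 2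
    _ ≤ ENNReal.ofReal (M ^ 2 / (4 * K)) := (ofReal_measureReal (measure_ne_top P _)).symm.trans_le (ENNReal.ofReal_le_ofReal hreal)

end Engine

/-! ## The pointwise counting step -/

section Pointwise

/-- Double counting: `Σ_{L ≤ j < K} L⁻¹ Σ_{k<L} x_{j-L+k} ≤ Σ_{l<K} x_l` for nonnegative `x` (each index occurs at most `L` times). -/
theorem sum_window_le {x : ℕ → ℝ} (hx : ∀ j, 0 ≤ x j) {L : ℕ} (hL : 1 ≤ L) (K : ℕ) :
    ∑ j ∈ Finset.Ico L K, (L : ℝ)⁻¹ * ∑ k ∈ Finset.range L, x (j - L + k) ≤ ∑ l ∈ Finset.range K, x l := by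
  have hwin : ∀ k ∈ Finset.range L, ∑ j ∈ Finset.Ico L K, x (j - L + k) ≤ ∑ l ∈ Finset.range K, x l := fun k hk => by
    rw [Finset.mem_range] at hk
    rw [← Finset.sum_image (s := Finset.Ico L K) (g := fun j => j - L + k) (f := x)
      (by intro a ha b hb hab; simp only [Finset.coe_Ico, Set.mem_Ico] at ha hb hab; omega)]
    refine Finset.sum_le_sum_of_subset_of_nonneg (fun l hl => ?_) fun l _ _ => hx l
    simp only [Finset.mem_image, Finset.mem_Ico, Finset.mem_range] at hl ⊢
    obtain ⟨j, ⟨hj1, hj2⟩, rfl⟩ := hl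
    omega
  calc ∑ j ∈ Finset.Ico L K, (L : ℝ)⁻¹ * ∑ k ∈ Finset.range L, x (j - L + k)
      = (L : ℝ)⁻¹ * ∑ k ∈ Finset.range L, ∑ j ∈ Finset.Ico L K, x (j - L + k) := by rw [← Finset.mul_sum, Finset.sum_comm]
    _ ≤ (L : ℝ)⁻¹ * ∑ k ∈ Finset.range L, ∑ l ∈ Finset.range K, x l :=
      mul_le_mul_of_nonneg_left (Finset.sum_le_sum hwin) (inv_nonneg.2 L.cast_nonneg)
    _ = ∑ l ∈ Finset.range K, x l := by
      rw [Finset.sum_const, Finset.card_range, nsmul_eq_mul, ← mul_assoc,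
        inv_mul_cancel₀ (show (L : ℝ) ≠ 0 by exact_mod_cast (by omega : L ≠ 0)), one_mul]

/-- `(a - M)₊ + a ∧ M = a`. -/
theorem max_add_min (a M : ℝ) : max (a - M) 0 + min a M = a := by
  rcases le_total a M with h | h
  · rw [max_eq_right (by linarith), min_eq_left h]; ring
  · rw [max_eq_left (by linarith), min_eq_right h]; ring

/-- **The pointwise step.**  For reals `x_j ≥ 0` and `p_j ≤ ρ L⁻¹ Σ_{k<L} x_{j-L+k} + C` (`L ≤ j < K`): on
`{4(C+1)/(1-ρ) < K⁻¹ Σ_{j<K} x_j}` one has `K ≤ Σ_{j<L} x_j`, or `K ≤ Σ_{j<K} (x_j - M)₊`, or `2K < Σ_{L ≤ j < K} (x_j ∧ M - p_j)`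
(since `x_j = (x_j - M)₊ + p_j + (x_j ∧ M - p_j)` and `Σ_j p_j ≤ ρ Σ_{j<K} x_j + C K` by `sum_window_le`). -/
theorem pointwise_engine {x p : ℕ → ℝ} {K L : ℕ} {ρ C M : ℝ} (hx : ∀ j, 0 ≤ x j) (hρ0 : 0 ≤ ρ) (hρ1 : ρ < 1) (hC : 0 ≤ C)
    (hL : 1 ≤ L) (hLK : L < K) (hp : ∀ j ∈ Finset.Ico L K, p j ≤ ρ * ((L : ℝ)⁻¹ * ∑ k ∈ Finset.range L, x (j - L + k)) + C)
    (h : 4 * (C + 1) / (1 - ρ) < (K : ℝ)⁻¹ * ∑ j ∈ Finset.range K, x j) :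
    (K : ℝ) ≤ ∑ j ∈ Finset.range L, x j ∨ (K : ℝ) ≤ ∑ j ∈ Finset.range K, max (x j - M) 0 ∨
      2 * (K : ℝ) < ∑ j ∈ Finset.Ico L K, (min (x j) M - p j) := by
  have hK : (0 : ℝ) < K := by exact_mod_cast lt_of_le_of_lt (Nat.zero_le L) hLK
  -- split the full sum at `L` and decompose the late blocks as `x_j = (x_j - M)₊ + p_j + (x_j ∧ M - p_j)`
  have hsplit := Finset.sum_range_add_sum_Ico x hLK.le
  have hdec : ∑ j ∈ Finset.Ico L K, x j = ∑ j ∈ Finset.Ico L K, max (x j - M) 0 + ∑ j ∈ Finset.Ico L K, p j +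
      ∑ j ∈ Finset.Ico L K, (min (x j) M - p j) := by
    rw [← Finset.sum_add_distrib, ← Finset.sum_add_distrib]
    exact Finset.sum_congr rfl fun j _ => by linarith [max_add_min (x j) M]
  have hS₂ : ∑ j ∈ Finset.Ico L K, max (x j - M) 0 ≤ ∑ j ∈ Finset.range K, max (x j - M) 0 :=
    Finset.sum_le_sum_of_subset_of_nonneg (fun j hj => Finset.mem_range.2 (Finset.mem_Ico.1 hj).2) fun j _ _ => le_max_right _ _
  have hP : ∑ j ∈ Finset.Ico L K, p j ≤ ρ * ∑ j ∈ Finset.range K, x j + C * K := by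
    refine (Finset.sum_le_sum hp).trans ?_
    rw [Finset.sum_add_distrib, Finset.sum_const, Nat.card_Ico, nsmul_eq_mul, ← Finset.mul_sum]
    exact add_le_add (mul_le_mul_of_nonneg_left (sum_window_le hx hL K) hρ0)
      ((mul_comm _ _).trans_le (mul_le_mul_of_nonneg_left (by exact_mod_cast Nat.sub_le K L) hC))
  have hh : 4 * (C + 1) * K < (1 - ρ) * ∑ j ∈ Finset.range K, x j := by
    rw [div_lt_iff₀ (sub_pos.2 hρ1)] at h
    calc 4 * (C + 1) * K < (K : ℝ)⁻¹ * (∑ j ∈ Finset.range K, x j) * (1 - ρ) * K := mul_lt_mul_of_pos_right h hK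
      _ = (1 - ρ) * (∑ j ∈ Finset.range K, x j) * ((K : ℝ)⁻¹ * K) := by ring
      _ = (1 - ρ) * ∑ j ∈ Finset.range K, x j := by rw [inv_mul_cancel₀ hK.ne', mul_one]
  have hCK : 0 ≤ C * K := mul_nonneg hC hK.le
  by_contra hcon
  push Not at hcon
  obtain ⟨hc1, hc2, hc3⟩ := hcon
  linarith

end Pointwise

/-- Stub 1 of line `Sketch` (crux `stmt-AtomisticToContinuum-16624`): the drift engine. -/
theorem stub_driftEngine : DriftEngine := by
  intro Ω mΩ P _ K L X ρ C M hXm hX0 hρ0 hρ1 hC hL hLK hM hdrift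
  -- Step 1: the predictor bound `π_j ≤ ρ H_j + C` a.e. for `L ≤ j < K`, from the drift tested on `σ(X₀, …, X_{j-1})`
  have hπ : ∀ᵐ ω ∂P, ∀ j, L ≤ j → j < K → pred X M P j ω ≤ ρ * ((L : ℝ)⁻¹ * ∑ k ∈ Finset.range L, X (j - L + k) ω) + C := by
    refine ae_all_iff.2 fun j => ?_
    by_cases! hj : ¬(L ≤ j ∧ j < K)
    · exact ae_of_all _ fun ω h1 h2 => (hj ⟨h1, h2⟩).elim
    obtain ⟨j, rfl⟩ : ∃ j', j = j' + 1 := ⟨j - 1, by omega⟩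
    have hB : Measurable[natF X (j + 1)] fun ω => ρ * ((L : ℝ)⁻¹ * ∑ k ∈ Finset.range L, X (j + 1 - L + k) ω) + C := by
      refine (((Finset.measurable_sum _ fun k hk => ?_).const_mul _).const_mul _).add_const _
      exact measurable_natF_of_lt X (by have := Finset.mem_range.1 hk; omega)
    have hB0 : ∀ ω, 0 ≤ ρ * ((L : ℝ)⁻¹ * ∑ k ∈ Finset.range L, X (j + 1 - L + k) ω) + C := fun ω =>
      add_nonneg (mul_nonneg hρ0 (mul_nonneg (inv_nonneg.2 L.cast_nonneg) (Finset.sum_nonneg fun k _ => hX0 _ ω))) hC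
    have key := condExp_le_of_drift (P := P) (h := fun ω (k : Fin (j + 1)) => X k ω) (measurable_pi_lambda _ fun k => hXm k) hM
      ((hXm (j + 1)).min measurable_const) (fun ω => le_min (hX0 _ ω) hM) (fun ω => min_le_right _ _)
      (fun ω => min_le_left _ _) hB hB0 (hdrift j hj.1 hj.2)
    filter_upwards [key] with ω hω _ _
    exact hω
  -- Step 2: a.e., the bad event forces one of three large sums (pointwise counting)
  have hincl : ∀ᵐ ω ∂P, 4 * (C + 1) / (1 - ρ) < (K : ℝ)⁻¹ * ∑ j ∈ Finset.range K, X j ω →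
      ((K : ℝ) ≤ ∑ j ∈ Finset.range L, X j ω ∨ (K : ℝ) ≤ ∑ j ∈ Finset.range K, max (X j ω - M) 0 ∨
        2 * (K : ℝ) < msum X M P L K ω) := by
    filter_upwards [hπ] with ω hω hbad
    exact pointwise_engine (x := fun j => X j ω) (p := fun j => pred X M P j ω) (M := M) (fun j => hX0 j ω) hρ0 hρ1 hC hL hLK
      (fun j hj => hω j (Finset.mem_Ico.1 hj).1 (Finset.mem_Ico.1 hj).2) hbad
  -- Step 3: union bound and Chebyshev
  calc P {ω | 4 * (C + 1) / (1 - ρ) < (K : ℝ)⁻¹ * ∑ j ∈ Finset.range K, X j ω}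
      ≤ P ({ω | (K : ℝ) ≤ ∑ j ∈ Finset.range L, X j ω} ∪ {ω | (K : ℝ) ≤ ∑ j ∈ Finset.range K, max (X j ω - M) 0} ∪
          {ω | 2 * (K : ℝ) < msum X M P L K ω}) := by
        refine measure_mono_ae (hincl.mono fun ω hω => ?_)
        intro hbad
        rcases hω hbad with h1 | h2 | h3
        exacts [Or.inl (Or.inl h1), Or.inl (Or.inr h2), Or.inr h3]
    _ ≤ P {ω | (K : ℝ) ≤ ∑ j ∈ Finset.range L, X j ω} + P {ω | (K : ℝ) ≤ ∑ j ∈ Finset.range K, max (X j ω - M) 0} +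
          P {ω | 2 * (K : ℝ) < msum X M P L K ω} := (measure_union_le _ _).trans (add_le_add (measure_union_le _ _) le_rfl)
    _ ≤ _ := add_le_add le_rfl (measure_msum_gt_le hXm hX0 hM hLK)

end Summit.AtomisticToContinuum.HydrodynamicLimit.Theorems.TransferActivityTailsDriftEngine

end
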